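import Literature.AlgebraicGeometry.Frobenioids.ArithmeticFrobenioidDivSlim
import Literature.AlgebraicGeometry.Frobenioids.ArithmeticFrobenioidIsotropic
import Literature.AlgebraicGeometry.Frobenioids.FinSubextCatFSM
import Literature.AlgebraicGeometry.Frobenioids.ModelFrobenioidStandard
import HarnessLib

/-!
# Frobenioids I, Example 6.3 / Theorem 6.4 (i): the hypotheses of Theorem 5.2 HOLD for the arithmetic
# data `(Φ, B, B → Φ^gp)` over `D = B(Gal(K/F))⁰` — PROOF

Mochizuki, *The geometry of Frobenioids I: the general theory*, Kyushu J. Math. **62** (2008) 293–400,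
Example 6.3, kurims text p. 113: "`Φ`, `B`, as well as the homomorphism `B → Φ^gp` are functorial in the
number field `F`. Thus, if `F̃` is a [not necessarily finite] Galois extension of `F`, `G = Gal(F̃/F)`, `D = B(G)⁰`, then
`Φ`, `B` determine monoids on `D`, and we have a natural homomorphism `B → Φ^gp`" and "Thus, by Theorem 5.2, (ii),
this data determines a [model] Frobenioid `C_{F̃/F}` of isotropic and birationally Frobenius-normalized type";
Theorem 5.2, p. 100 (standing hypotheses: `Φ` a divisorial monoid on a connected, totally epimorphic category `D`,
`B` a group-like monoid on `D`). [cite: MochizukiFrdI2008, Ex. 6.3 p.113]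

PROOF-ONLY companion (seat abc-iut-L6-t10, discharge of the standing hypotheses of Thm. 5.2 for THE
constructed arithmetic model `arithFrobenioid F K := ModelFrobenioid (arithDivisorFunctor F K) (unitsFunctor F K)
(divNatTrans F K)`, `ArithmeticFrobenioidModel.lean`), in the packaging `ModelFrobenioid.Hypotheses` of
abc-iut-L1-t2 (`ModelFrobenioidStandard.lean`), so that abc-iut-found's `ModelFrobenioid.isFrobenioid`
(Thm. 5.2 (ii)) and abc-iut-L1-t2's `ModelFrobenioid.StandardTypeIff` (Thm. 5.2 (iii)) apply to `C_{K/F}`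
verbatim. PROVED here, for number fields `F ⊆ K` with `K/F` Galois:
* `isDivisorial_multiplicative_of` — a divisoriality criterion for additively written monoids (sharp,
  cancellative, "`n·a = c + n·b ⇒ b ≤ a`"), and with it `EffArithDivisor.isDivisorial`: the monoid
  `Φ(L) = ⊕_{v ∤ ∞} ℤ_{≥0} ⊕ ⊕_{v | ∞} ℝ_{≥0}` of effective arithmetic divisors is DIVISORIAL (Def. 1.1 (i));
* `FinSubextCat.isGraphConnected`, `FinSubextCat.isTotallyEpimorphic`: `D = B(Gal(K/F))⁰` is connected
  (every `Spec L` maps to `Spec F`) and totally epimorphic (field homomorphisms are injective);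
* `arithDivisorFunctor_isMonoidOn`, `unitsFunctor_isMonoidOn`: `Φ` and `B` are monoids on `D`
  (Def. 1.1 (ii): pull-backs characteristically injective — `ArithPullback.pullback_injective`,
  `ArithmeticFrobenioidDivSlim.lean`; FSM-morphisms of `D` are isomorphisms — `FinSubextCat.isOfFSMType`,
  `FinSubextCatFSM.lean` — hence pull back to bijections);
* `arith_hypotheses : ModelFrobenioid.Hypotheses (arithDivisorFunctor F K) (unitsFunctor F K)`.
No definitions; nothing here bears on [IUTchIII] or asserts anything about abc.
-/

noncomputable section

namespace Literature.AlgebraicGeometry.Frobenioids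

open CategoryTheory Opposite NumberField Function

universe u

/-! ### A divisoriality criterion for additively written monoids -/

/-- A cancellative additive monoid `L` with no units but `0` in which `n·a = c + n·b` (`n ≥ 1`) forces
`b ≤ a` (i.e. `a = d + b` for some `d`) is, written multiplicatively, a DIVISORIAL monoid in the sense of
FrdI Def. 1.1 (i): integral, saturated, of characteristic type and sharp (§0 p. 11).
[cite: MochizukiFrdI2008, Def. 1.1 (i) p.19] -/
theorem isDivisorial_multiplicative_of {L : Type u} [AddCommMonoid L] [IsCancelAdd L]
    (hsharp : ∀ a b : L, a + b = 0 → a = 0)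
    (hsat : ∀ (a b c : L) (n : ℕ), 0 < n → n • a = c + n • b → ∃ d, a = d + b) :
    IsDivisorial (Multiplicative L) := by
  have sharp : IsSharp (Multiplicative L) := by
    refine ⟨fun a ha => ?_⟩
    obtain ⟨u, rfl⟩ := ha
    have h : Multiplicative.toAdd (u : Multiplicative L) +
        Multiplicative.toAdd ((u⁻¹ : (Multiplicative L)ˣ) : Multiplicative L) = 0 := by
      rw [← toAdd_mul, Units.mul_inv, toAdd_one]
    exact Multiplicative.toAdd.injective (hsharp _ _ h)
  refine ⟨⟨⟨Algebra.GrothendieckGroup.of_injective⟩, ⟨fun x n hn ⟨c, hc⟩ => ?_⟩,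
    ⟨fun u _ _ => Units.ext (sharp.1 (u : Multiplicative L) u.isUnit)⟩⟩, sharp⟩
  obtain ⟨⟨a, b⟩, h⟩ := (Localization.monoidOf (⊤ : Submonoid (Multiplicative L))).surj x
  have hb : x = Algebra.GrothendieckGroup.of a / Algebra.GrothendieckGroup.of (b : Multiplicative L) :=
    eq_div_iff_mul_eq'.mpr h
  have hab : a ^ n = c * (b : Multiplicative L) ^ n := by
    apply Algebra.GrothendieckGroup.of_injective
    rw [map_mul, map_pow, map_pow, hc, hb, div_pow, div_mul_cancel]
  have h' : n • Multiplicative.toAdd a =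
      Multiplicative.toAdd c + n • Multiplicative.toAdd (b : Multiplicative L) := by
    rw [← toAdd_pow, hab, toAdd_mul, toAdd_pow]
  obtain ⟨d, hd⟩ := hsat _ _ _ n hn h'
  refine ⟨Multiplicative.ofAdd d, ?_⟩
  rw [hb, eq_div_iff_mul_eq', ← map_mul]
  congr 1
  apply Multiplicative.toAdd.injective
  rw [toAdd_mul, toAdd_ofAdd, hd]

/-! ### `Φ(L)` is divisorial -/

namespace EffArithDivisor

variable (L : Type) [Field L] [NumberField L]

/-- **Example 6.3** (FrdI p. 113 "`Φ`, `B` determine monoids on `D`"; divisorial as required by Thm. 5.2): the monoid `Φ(L)` of effective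
arithmetic divisors on a number field `L` is DIVISORIAL (Def. 1.1 (i)) — PROVED: it is cancellative with no
units but `0`, and `n·a = c + n·b` forces `b ≤ a` coordinatewise in `ℤ_{≥0}` and in `ℝ_{≥0}`.
[cite: MochizukiFrdI2008, Ex. 6.3 p.113] -/
theorem isDivisorial : IsDivisorial (Multiplicative (EffArithDivisor L)) := by
  refine isDivisorial_multiplicative_of (fun a b h => ?_) (fun a b c n hn h => ?_)
  · refine Prod.ext (Finsupp.ext fun v => ?_) (funext fun w => ?_)
    · have := DFunLike.congr_fun (congrArg Prod.fst h) v
      simp only [Prod.fst_add, Finsupp.coe_add, Pi.add_apply, Prod.fst_zero, Finsupp.coe_zero,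
        Pi.zero_apply, add_eq_zero] at this
      simpa using this.1
    · have := congrFun (congrArg Prod.snd h) w
      simp only [Prod.snd_add, Pi.add_apply, Prod.snd_zero, Pi.zero_apply, add_eq_zero] at this
      simpa using this.1
  · have h1 : ∀ v, b.1 v ≤ a.1 v := fun v => by
      have := DFunLike.congr_fun (congrArg Prod.fst h) v
      simp only [Prod.smul_fst, Finsupp.smul_apply, smul_eq_mul, Prod.fst_add, Finsupp.coe_add,
        Pi.add_apply] at this
      exact Nat.le_of_mul_le_mul_left (by rw [this]; exact Nat.le_add_left _ _) hn
    have h2 : ∀ w, b.2 w ≤ a.2 w := fun w => by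
      have := congrFun (congrArg Prod.snd h) w
      simp only [Prod.smul_snd, Pi.smul_apply, Prod.snd_add, Pi.add_apply] at this
      exact le_of_nsmul_le_nsmul_right hn.ne' (by rw [this]; exact le_add_self)
    refine ⟨(a.1 - b.1, fun w => a.2 w - b.2 w), Prod.ext (Finsupp.ext fun v => ?_) (funext fun w => ?_)⟩
    · simp only [Prod.fst_add, Finsupp.coe_add, Finsupp.coe_tsub, Pi.add_apply, Pi.sub_apply]
      exact (tsub_add_cancel_of_le (h1 v)).symm
    · simp only [Prod.snd_add, Pi.add_apply]
      exact (tsub_add_cancel_of_le (h2 w)).symm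

end EffArithDivisor

/-! ### `D = B(Gal(K/F))⁰` is connected and totally epimorphic -/

namespace FinSubextCat

variable {F : Type u} [Field F] {K : Type u} [Field K] [Algebra F K]

variable (F K) in
/-- **`D` is connected** (the standing hypothesis of Thm. 5.2 for `D = B(G)⁰`, FrdI p. 100; §0 p. 16): every
`Spec L` maps to `Spec F` (the object given by the bottom intermediate field), so any two objects are joined
by a zigzag. [cite: MochizukiFrdI2008, Thm. 5.2 p.100] -/
theorem isGraphConnected : IsGraphConnected (FinSubextCat F K) := by
  let B : FinSubextCat F K := ⟨⊥⟩
  have toB : ∀ X : FinSubextCat F K, X ⟶ B := fun X => ⟨IntermediateField.inclusion bot_le⟩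
  exact ⟨⟨B⟩, fun X Y => (Zigzag.of_hom (toB X)).trans (Zigzag.of_inv (toB Y))⟩

variable (F K) in
/-- **`D` is totally epimorphic** (the standing hypothesis of Thm. 5.2 for `D = B(G)⁰`, FrdI p. 100; §0 p. 15):
a morphism `Spec L → Spec M` is an `F`-algebra map `M → L` of fields, which is injective, so it is
right-cancellable. [cite: MochizukiFrdI2008, Thm. 5.2 p.100] -/
theorem isTotallyEpimorphic : IsTotallyEpimorphic (FinSubextCat F K) := by
  refine ⟨fun {X Y} f => ⟨fun {Z} g h hgh => hom_ext (AlgHom.ext fun z => ?_)⟩⟩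
  have := congrArg (fun k : X ⟶ Z => k.toAlgHom z) hgh
  exact (f.toAlgHom : Y.L →+* X.L).injective this

end FinSubextCat

/-! ### `Φ` and `B` are monoids on `D` -/

section Monoids

variable (F : Type) [Field F] [NumberField F] (K : Type) [Field K] [Algebra F K] [IsGalois F K]

/-- The underlying map of an isomorphism of `CommMonCat` is bijective. [cite: MochizukiFrdI2008, Def. 1.1 (ii) p.19] -/
private theorem bijective_hom_of_isIso_arith {X Y : CommMonCat.{0}} (f : X ⟶ Y) [IsIso f] :
    Bijective f.hom := by
  refine bijective_iff_has_inverse.mpr ⟨(inv f).hom, fun x => ?_, fun y => ?_⟩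
  · change (f ≫ inv f).hom x = x
    rw [IsIso.hom_inv_id]
    rfl
  · change (inv f ≫ f).hom y = y
    rw [IsIso.inv_hom_id]
    rfl

/-- **Example 6.3: `Φ` is a monoid on `D`** (FrdI Def. 1.1 (ii); p. 113 "`Φ`, `B` determine monoids on `D`") — PROVED for `K/F` Galois: (a) the pull-back `σ^* : Φ(M) → Φ(L)` is injective
(`ArithPullback.pullback_injective`) into a sharp monoid, hence characteristically injective; (b) every
FSM-morphism of `D` is an isomorphism (`FinSubextCat.isOfFSMType`), so it pulls back to a bijection.
[cite: MochizukiFrdI2008, Ex. 6.3 p.113] -/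
theorem arithDivisorFunctor_isMonoidOn : IsMonoidOn (arithDivisorFunctor F K) := by
  refine ⟨fun {X Y} σ => ?_, fun {X Y} σ hσ => ?_⟩
  · have hinj : Injective (pull (arithDivisorFunctor F K) σ) := fun x y h =>
      Multiplicative.toAdd.injective
        (ArithPullback.pullback_injective σ.toAlgHom.toRingHom (congrArg Multiplicative.toAdd h))
    refine ⟨hinj, fun x y hxy => ?_⟩
    obtain ⟨a, rfl⟩ := Associates.mk_surjective x
    obtain ⟨b, rfl⟩ := Associates.mk_surjective y
    rw [associatesMap_mk, associatesMap_mk, Associates.mk_eq_mk_iff_associated] at hxy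
    obtain ⟨w, hw⟩ := hxy
    have hw1 : (w : (arithDivisorFunctor F K).obj (op Y)) = 1 :=
      (EffArithDivisor.isDivisorial Y.L).isSharp.1 _ w.isUnit
    rw [hw1, mul_one] at hw
    rw [hinj hw]
  · haveI : IsIso σ := (FinSubextCat.isOfFSMType F K).isIso_of_isFSM σ hσ
    haveI : IsIso ((arithDivisorFunctor F K).map σ.op) := inferInstance
    exact bijective_hom_of_isIso_arith ((arithDivisorFunctor F K).map σ.op)

omit [NumberField F] in
/-- **Example 6.3: `B` is a monoid on `D`** (FrdI Def. 1.1 (ii); p. 113 "a group-like monoid `B` on `D`") —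
PROVED for `K/F` Galois: (a) `B(M) = M^× → L^× = B(L)` is injective (a homomorphism of fields) and `B(M)^char`
is trivial; (b) FSM-morphisms of `D` are isomorphisms. [cite: MochizukiFrdI2008, Ex. 6.3 p.113] -/
theorem unitsFunctor_isMonoidOn : IsMonoidOn (unitsFunctor F K) := by
  refine ⟨fun {X Y} σ => ?_, fun {X Y} σ hσ => ?_⟩
  · refine ⟨?_, ?_⟩
    · change Injective (Units.map (σ.toAlgHom : X.L →* Y.L))
      exact Units.map_injective (σ.toAlgHom : X.L →+* Y.L).injective
    · haveI : Subsingleton (Associates ((unitsFunctor F K).obj (op X))) :=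
        (unitsFunctor_isGroupLike F K X).subsingleton_associates
      exact injective_of_subsingleton _
  · haveI : IsIso σ := (FinSubextCat.isOfFSMType F K).isIso_of_isFSM σ hσ
    haveI : IsIso ((unitsFunctor F K).map σ.op) := inferInstance
    exact bijective_hom_of_isIso_arith ((unitsFunctor F K).map σ.op)

omit [IsGalois F K] in
/-- `Φ` is (objectwise) divisorial. [cite: MochizukiFrdI2008, Ex. 6.3 p.113] -/
theorem arithDivisorFunctor_isDivisorial :
    Objectwise (fun M _ => IsDivisorial M) (arithDivisorFunctor F K) :=
  fun X => EffArithDivisor.isDivisorial X.L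

/-- **Example 6.3 / Theorem 6.4 (i): the hypotheses of Theorem 5.2 hold for `(Φ, B)` over `D = B(Gal(K/F))⁰`**
(FrdI p. 113 "Thus, by Theorem 5.2, (ii), this data determines a [model] Frobenioid"; p. 114 "`C_i` the
associated model Frobenioid of Theorem 5.2, (ii)") — PROVED, in abc-iut-L1-t2's packaging
`ModelFrobenioid.Hypotheses`: `Φ` a divisorial monoid on `D`, `B` a group-like monoid on `D`, `D` connected
and totally epimorphic. [cite: MochizukiFrdI2008, Thm. 6.4 (i) p.114] -/
theorem arith_hypotheses : ModelFrobenioid.Hypotheses (arithDivisorFunctor F K) (unitsFunctor F K) where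
  isMonoidOn := arithDivisorFunctor_isMonoidOn F K
  isDivisorial := arithDivisorFunctor_isDivisorial F K
  isMonoidOn_rat := unitsFunctor_isMonoidOn F K
  isGroupLike_rat := unitsFunctor_isGroupLike F K
  isGraphConnected := FinSubextCat.isGraphConnected F K
  isTotallyEpimorphic := FinSubextCat.isTotallyEpimorphic F K

end Monoids

end Literature.AlgebraicGeometry.Frobenioids

end
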